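import Literature.AnabelianGeometry.EtaleTheta.ArithThetaTowerEnvelopeModel
import Literature.AnabelianGeometry.EtaleTheta.DivisorMonoidsOfGaloisCoveringConnected
import Literature.AnabelianGeometry.EtaleTheta.ArithThetaTowerPrelim
import Literature.AnabelianGeometry.EtaleTheta.Discharge.Sec3Prop34iiOfGaloisCovering
import HarnessLib

/-!
# [IUTchI] Ex. 3.2 / [EtTh] Def. 3.3 (iii) — GAP A item GA-10 (file 2 of 2, re-targeted to `ArithThetaTowerDivisorsGeom.lean` by the pen's
# C-R257): the DECK ACTION on the level model of the theta envelope, the GEOMETRIC ENVELOPE DATA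
# `ArithThetaTower.divisorsGeom : DivisorMonoids (CosetCat Γ)` (`Φ₀^geom / B₀^geom / div₀^geom`), and the theta section with its «log-divisor of
# zeroes and poles»

S. Mochizuki, *The étale theta function …*, Publ. RIMS **45** (2009) [MochizukiEtTh2009], Def. 3.3 (iii) p.299 (PDF p.73) («`Φ₀(Y^log) :=
lim Div⁺(Z^log_∞)^{Gal(Z^log_∞/Y^log)}`; `B₀(Y^log) := lim Mero(Z^log_∞)^{Gal(Z^log_∞/Y^log)}` … a natural transformation `B₀ → Φ₀^gp` [given by
assigning to a log-meromorphic function its log-divisor of zeroes and poles]»), Rmk. 3.3.1 p.299, Prop. 1.4 p.247 (PDF p.21), §5 p.330 (PDF p.104)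
(«… an element of `O^×(A_⊙^birat)`»); [FrdII] Ex. 1.3 (i) p.11; [IUTchI] Ex. 3.2 (i)(ii) pp.70–71. [cite: MochizukiEtTh2009, Def 3.3 p.73]

abc-iut cell, GAP A (gap G-L5-EX32I-1), item **GA-10** (D2 geometric half of `GAP-SIZING-A.md` 69de97346848d3e8; RULINGS #317 (2) / #319 / #321 /
#322 (c2′)(c3′); ruled shapes `plan/L5/GAP-A-SIGNATURES.md` v1 e3ccddf9b87597cf §2 «`Φ₀^geom` on `CosetCat Γ` := `DivisorMonoids.ofGaloisActionConnected`
of the Γ-action on (special-fibre components ⊔ cusps) … `B₀^geom` BY NAME … `div₀` transported from `div₀_thetaB₀`»; SIGNATURE + SIG-DELTA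
`(Γ) [Group Γ] [TopologicalSpace Γ] (C : Type) [MulAction Γ C]` countersigned RULINGS #338 (B)).  CLASS (b) CONSTRUCTION; consumed BY NAME: file 1
`Envelope.model` / `cuspLaws` / `theta` / `divisor_theta`, abc-iut-w6-d058's `LogDivisorModel.GaloisAction`, `DivisorMonoids.ofGaloisAction[Connected]`,
`divZeroHom_eq_div_iff`, `exists_bZero/phiZero_quotient_of_invariant`, abc-iut-w5-d179's `DivisorMonoids.precomp`, GA-02's `cosetGSetFunctor`
(★ p666726).  GA-02's own `T`-indexed avatar `envelopeModel T` / `envelopeAction T` (`ArithThetaTowerEnvelope.lean`, ★ p668980; ONE cusp per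
component) is the specialisation `C := Π ⧸ Π_Ÿ` of file 1's `Envelope.model` up to the 2:1 collapse of the cusps `(c, ±) ↦ c` — the dictionary
is the sequel `ArithThetaTowerDivisorsGeomBridge.lean` (pen C-R257 (3)).  THIS FILE:
* **`Envelope.action C Γ : (Envelope.model C).GaloisAction Γ`** for ANY group acting on the components (`[MulAction Γ C]`) — THE DECK ACTION
  `Θ̈_c ↦ Θ̈_{γ•c}`, `F_c ↦ F_{γ•c}`, cusp `(c, ±) ↦ (γ•c, ±)`, all eleven laws PROVED; `actFn_theta`, `actDIV_thetaZeros` (zero divisor INVARIANT),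
  `actDIV_thetaPoles` (`γ·[F_c] = [F_{γ•c}]`);
* `cosetConnectedFunctor Γ : CosetCat Γ ⥤ D₀` (lift of `cosetGSetFunctor`, `U ↦ Γ/U`, one orbit) and THE RULED DECL **`divisorsGeom Γ C :
  DivisorMonoids.{0,0,0} (CosetCat Γ) := (ofGaloisActionConnected (Envelope.action C Γ) (Envelope.cuspLaws C)).precomp (cosetConnectedFunctor Γ)`**
  with `divisorsGeom_eq` (`rfl` onto GA-02's engine route `(ofGaloisAction …).precomp (cosetGSetFunctor Γ)`), the `rfl` shapes of `Φ₀/B₀/div₀/F₀`, and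
  injective transitions;
* the THETA SECTION over `Γ/Y` for `Y` stabilising a component `c₀`: **`thetaSection Y hY ∈ B₀^geom(Γ/Y)`** (`γ·Y ↦ Θ̈_{γ•c₀}`), the families
  `thetaZerosΦ₀` (all cusps; at EVERY object; cuspidal, `≠ 1`) and `thetaPolesΦ₀ Y hY` (`γ·Y ↦ [F_{γ•c₀}]`; non-cuspidal), **`div₀_thetaSection :
  div₀ θ = [thetaZerosΦ₀] / [thetaPolesΦ₀]`** (transport of the fourth model's `div₀_thetaB₀`, `ThetaFractionPairOfThetaTwistTower.lean`),
  disjointness of their supports, and the canonical instance `thetaSectionSelf Y` at the tautological component set `C := Γ/Y`.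
HONEST FRAMING: a class-(b) construction over typed interfaces; the envelope is a LABELLED finite-level TRANSPORT of print's [EtTh] §1 recipe (carrier
label (c3′) and #322 GUARD in `divisorsGeom`'s docstring); NOT the tempered Frobenioid of a Tate curve; no Prop-valued fact, no instance, no notation,
no sorry; nothing here bears on [IUTchIII] Cor. 3.12; NO side taken (D-0045); typed ≠ inhabited ≠ proved-in-print; count-neutral; NO abc claim.
-/

noncomputable section

namespace Literature.AnabelianGeometry.EtaleTheta

namespace ArithThetaTower

namespace Envelope

open LogDivisorModel

variable (C : Type) (Γ : Type) [Group Γ] [MulAction Γ C]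

/-! ## §0 Field read-outs of the level model (`rfl`; named for GA-12's `F3`, keeper-A pin π5) -/
/-- `const = ⊥` (no constants in the geometric factor). [cite: MochizukiEtTh2009, Def 3.1 p.70] -/
theorem model_const : (model C).const = ⊥ := rfl
/-- `intConst = ⊥`. [cite: MochizukiEtTh2009, Def 3.1 p.70] -/
theorem model_intConst : (model C).intConst = ⊥ := rfl
/-- `logMero = ⊤` (every theta monomial is log-meromorphic). [cite: MochizukiEtTh2009, Def 3.1 p.70] -/
theorem model_logMero : (model C).logMero = ⊤ := rfl
/-- `Div = ⊤` (every log-divisor Cartier). [cite: MochizukiEtTh2009, Def 3.1 p.70] -/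
theorem model_Div : (model C).Div = ⊤ := rfl

/-! ## §1 The deck action of a group `Γ` acting on the components -/

/-- `Γ` permuting the cusps `(c, ±) ↦ (γ • c, ±)`. [cite: MochizukiEtTh2009, Rmk 3.3.1 p.73] -/
def permCusp : Γ →* Equiv.Perm (Cusp C) where
  toFun g := Equiv.prodCongr (MulAction.toPerm g) (Equiv.refl Bool)
  map_one' := Equiv.ext fun x => Prod.ext (one_smul Γ x.1) rfl
  map_mul' g h := Equiv.ext fun x => Prod.ext (mul_smul g h x.1) rfl

/-- `Γ` permuting the prime log-divisors `cusps ⊔ components`. [cite: MochizukiEtTh2009, Rmk 3.3.1 p.73] -/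
def permIdx : Γ →* Equiv.Perm (Idx C) :=
  (Equiv.Perm.sumCongrHom (Cusp C) C).comp ((permCusp C Γ).prod (MulAction.toPermHom Γ C))

/-- `permIdx` on a cusp. [cite: MochizukiEtTh2009, Rmk 3.3.1 p.73] -/
@[simp] theorem permIdx_inl (g : Γ) (c : C) (b : Bool) : permIdx C Γ g (Sum.inl (c, b)) = Sum.inl (g • c, b) := rfl

/-- `permIdx` on a component. [cite: MochizukiEtTh2009, Rmk 3.3.1 p.73] -/
@[simp] theorem permIdx_inr (g : Γ) (c : C) : permIdx C Γ g (Sum.inr c) = Sum.inr (g • c) := rfl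

/-- `permIdx = Sum.map (permCusp) (toPerm)`. [cite: MochizukiEtTh2009, Rmk 3.3.1 p.73] -/
theorem sum_map_perm (g : Γ) (x : Idx C) : Sum.map (permCusp C Γ g) (MulAction.toPermHom Γ C g) x = permIdx C Γ g x := by
  rcases x with ⟨c, b⟩ | c <;> rfl

/-- The inverse permutation is the permutation of the inverse. [cite: MochizukiEtTh2009, Rmk 3.3.1 p.73] -/
theorem permIdx_symm_apply (g : Γ) (x : Idx C) : (permIdx C Γ g).symm x = permIdx C Γ g⁻¹ x := by
  rw [← Equiv.Perm.inv_def, ← map_inv]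

/-- The action of a permutation `σ` of the prime log-divisors on log-divisors: `d ↦ d ∘ σ⁻¹`. [cite: MochizukiEtTh2009, Def 3.3 p.73] -/
def shiftDIV (σ : Equiv.Perm (Idx C)) : Multiplicative (Idx C → ℤ) ≃* Multiplicative (Idx C → ℤ) where
  toFun d := Multiplicative.ofAdd fun x => Multiplicative.toAdd d (σ.symm x)
  invFun d := Multiplicative.ofAdd fun x => Multiplicative.toAdd d (σ x)
  left_inv d := Multiplicative.toAdd.injective (funext fun x => by simp)
  right_inv d := Multiplicative.toAdd.injective (funext fun x => by simp)
  map_mul' _ _ := Multiplicative.toAdd.injective (funext fun x => by simp)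

/-- `shiftDIV σ d` evaluated. [cite: MochizukiEtTh2009, Def 3.3 p.73] -/
@[simp] theorem toAdd_shiftDIV (σ : Equiv.Perm (Idx C)) (d : Multiplicative (Idx C → ℤ)) (x : Idx C) :
    Multiplicative.toAdd (shiftDIV C σ d) x = Multiplicative.toAdd d (σ.symm x) := by
  simp [shiftDIV]

/-- `Γ` acting on the log-divisors of the level. [cite: MochizukiEtTh2009, Def 3.3 p.73] -/
def actDIVHom : Γ →* MulAut (Multiplicative (Idx C → ℤ)) where
  toFun g := shiftDIV C (permIdx C Γ g)
  map_one' := MulEquiv.ext fun d => Multiplicative.toAdd.injective (funext fun x => by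
    rw [toAdd_shiftDIV, map_one, MulAut.one_apply]
    rfl)
  map_mul' g h := MulEquiv.ext fun d => Multiplicative.toAdd.injective (funext fun x => by
    rw [MulAut.mul_apply, toAdd_shiftDIV, toAdd_shiftDIV, toAdd_shiftDIV, map_mul]
    rfl)

/-- The action of a permutation `σ` of the components on the theta translates: `Θ̈_c ↦ Θ̈_{σ c}`. [cite: MochizukiEtTh2009, Prop 1.4 p.22] -/
def actFnEquiv (σ : Equiv.Perm C) : Multiplicative (C →₀ ℤ) ≃* Multiplicative (C →₀ ℤ) :=
  AddEquiv.toMultiplicative (Finsupp.domCongr σ)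

/-- `actFnEquiv σ f` as a finitely supported function: `equivMapDomain σ`. [cite: MochizukiEtTh2009, Prop 1.4 p.22] -/
theorem toAdd_actFnEquiv (σ : Equiv.Perm C) (f : Multiplicative (C →₀ ℤ)) :
    Multiplicative.toAdd (actFnEquiv C σ f) = Finsupp.equivMapDomain σ (Multiplicative.toAdd f) := rfl

/-- `actFnEquiv σ f` evaluated: the exponent of `Θ̈_c` in `σ · f` is that of `Θ̈_{σ⁻¹ c}` in `f`. [cite: MochizukiEtTh2009, Prop 1.4 p.22] -/
@[simp] theorem toAdd_actFnEquiv_apply (σ : Equiv.Perm C) (f : Multiplicative (C →₀ ℤ)) (c : C) :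
    Multiplicative.toAdd (actFnEquiv C σ f) c = Multiplicative.toAdd f (σ.symm c) := rfl

/-- `Γ` acting on the functions of the level (`Θ̈_c ↦ Θ̈_{γ • c}`). [cite: MochizukiEtTh2009, Def 3.3 p.73] -/
def actFnHom : Γ →* MulAut (Multiplicative (C →₀ ℤ)) where
  toFun g := actFnEquiv C (MulAction.toPerm g)
  map_one' := MulEquiv.ext fun f => Multiplicative.toAdd.injective (Finsupp.ext fun c => by
    rw [toAdd_actFnEquiv_apply, MulAction.toPerm_symm_apply, inv_one, one_smul, MulAut.one_apply])
  map_mul' g h := MulEquiv.ext fun f => Multiplicative.toAdd.injective (Finsupp.ext fun c => by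
    rw [MulAut.mul_apply, toAdd_actFnEquiv_apply, toAdd_actFnEquiv_apply, toAdd_actFnEquiv_apply, MulAction.toPerm_symm_apply,
      MulAction.toPerm_symm_apply, MulAction.toPerm_symm_apply, mul_inv_rev, mul_smul])

/-- **THE DECK ACTION of `Γ` on the level model** — translates, components and cusps permuted through the action of `Γ` on `C`; every law of
abc-iut-w6-d058's parameter record PROVED (in particular `divisor_act`: `div Θ̈_{γ•c} = γ · div Θ̈_c`, the zero divisor being invariant and
`γ·[F_c] = [F_{γ•c}]`). [cite: MochizukiEtTh2009, Def 3.3 p.73] -/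
def action : (model C).GaloisAction Γ where
  actFn := actFnHom C Γ
  actDIV := actDIVHom C Γ
  permCusp := permCusp C Γ
  permComp := MulAction.toPermHom Γ C
  act_mem_DIVplus g d hd := (ofAdd_mem_effective_iff C _).2 fun x => hd _
  act_mem_Div _ _ _ := trivial
  act_mem_logMero _ _ _ := trivial
  act_mem_const g f hf := by
    have h : f = 1 := (Subgroup.mem_bot).1 hf
    rw [h, map_one]
    exact Subgroup.one_mem _
  act_mem_intConst g f hf := by
    have h : f = 1 := (Submonoid.mem_bot).1 hf
    rw [h, map_one]
    exact Submonoid.one_mem _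
  divisor_act g f := by
    refine Multiplicative.toAdd.injective (funext fun x => ?_)
    change divFun C (Multiplicative.toAdd (actFnEquiv C (MulAction.toPerm g) f.1)) x =
      Multiplicative.toAdd (shiftDIV C (permIdx C Γ g) (divHom C f.1)) x
    rw [toAdd_shiftDIV, toAdd_divHom, permIdx_symm_apply]
    rcases x with ⟨c, b⟩ | c
    · rw [permIdx_inl, divFun_inl, divFun_inl, toAdd_actFnEquiv, deg_equivMapDomain]
    · rw [permIdx_inr, divFun_inr, divFun_inr, toAdd_actFnEquiv_apply, MulAction.toPerm_symm_apply]
  mult_act g d x := by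
    change (Multiplicative.toAdd (shiftDIV C (permIdx C Γ g) d.1) (Sum.map (permCusp C Γ g) (MulAction.toPermHom Γ C g) x)).toNat =
      (Multiplicative.toAdd d.1 x).toNat
    rw [toAdd_shiftDIV, sum_map_perm, Equiv.symm_apply_apply]
    rfl

/-- The action on functions, unfolded. [cite: MochizukiEtTh2009, Def 3.3 p.73] -/
theorem action_actFn (g : Γ) : (action C Γ).actFn g = actFnEquiv C (MulAction.toPerm g) := rfl

/-- The action on log-divisors, unfolded. [cite: MochizukiEtTh2009, Def 3.3 p.73] -/
theorem action_actDIV (g : Γ) : (action C Γ).actDIV g = shiftDIV C (permIdx C Γ g) := rfl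

/-- **`γ · Θ̈_c = Θ̈_{γ • c}`.** [cite: MochizukiEtTh2009, Prop 1.4 p.22] -/
theorem actFn_theta (g : Γ) (c : C) : (action C Γ).actFn g (theta c) = theta (g • c) :=
  Multiplicative.toAdd.injective (by
    change Finsupp.equivMapDomain (MulAction.toPerm g) (Finsupp.single c 1) = Finsupp.single (g • c) 1
    exact Finsupp.equivMapDomain_single _ _ _)

/-- **The zero divisor of the theta translates (all cusps, multiplicity `1`) is INVARIANT under the deck action.**
[cite: MochizukiEtTh2009, Prop 1.4 p.21] -/
theorem actDIV_thetaZeros (g : Γ) : (action C Γ).actDIV g (thetaZeros C : (model C).DIV) = thetaZeros C := by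
  refine Multiplicative.toAdd.injective (funext fun x => ?_)
  change zerosFun C ((permIdx C Γ g).symm x) = zerosFun C x
  rcases x with ⟨c, b⟩ | c <;> rfl

/-- **`γ · [F_c] = [F_{γ • c}]`**: the decreed polar divisors of the translates are permuted along with the translates.
[cite: MochizukiEtTh2009, Rmk 1.3.1 p.21] -/
theorem actDIV_thetaPoles (g : Γ) (c : C) :
    (action C Γ).actDIV g (thetaPoles c : (model C).DIV) = (thetaPoles (g • c) : (model C).DIV) := by
  refine Multiplicative.toAdd.injective (funext fun x => ?_)
  change polesFun c ((permIdx C Γ g).symm x) = polesFun (g • c) x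
  rcases x with ⟨c', b⟩ | c'
  · rfl
  · change Finsupp.single c (1 : ℤ) (g⁻¹ • c') = Finsupp.single (g • c) (1 : ℤ) c'
    classical
    rw [Finsupp.single_apply, Finsupp.single_apply, eq_inv_smul_iff]

end Envelope

/-! ## §2 The Def. 3.3 (iii) data `divisorsGeom` over the small coset category `CosetCat Γ` -/

section Geom

open CategoryTheory Opposite Literature.AnabelianGeometry.SemiGraphs LogDivisorModel LogDivisorModel.GaloisAction

variable (Γ : Type) [Group Γ] [TopologicalSpace Γ] (C : Type) [MulAction Γ C]

/-- **`CosetCat Γ ⥤ D₀`**: the open subgroup `U` (object `Γ/U`) as a CONNECTED `Γ`-set — the lift of GA-02's `cosetGSetFunctor Γ` (`U ↦ Γ/U`,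
one orbit) to abc-iut-w6-d058's full subcategory `isConnectedGSet` of Def. 3.3's `D₀`. [cite: MochizukiEtTh2009, Def 3.3 p.73] -/
def cosetConnectedFunctor : CosetCat Γ ⥤ (isConnectedGSet (G := Γ)).FullSubcategory :=
  (isConnectedGSet (G := Γ)).lift (cosetGSetFunctor Γ) (isConnectedGSet_cosetGSetFunctor_obj Γ)

/-- On objects: the `Γ`-set `Γ/U`. [cite: MochizukiEtTh2009, Def 3.3 p.73] -/
theorem cosetConnectedFunctor_obj (U : CosetCat Γ) : ((cosetConnectedFunctor Γ).obj U).obj = Action.ofMulAction Γ U.carrier := rfl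

/-- **GA-10 — THE GEOMETRIC ENVELOPE DATA `Φ₀^geom / B₀^geom / div₀^geom`** ([EtTh] Def. 3.3 (iii) at the level model of the theta envelope with
its deck action): `DivisorMonoids.ofGaloisActionConnected` (RULED builder, RULINGS #321 (ii) / GAP-A-SIGNATURES §2) of `Envelope.action C Γ`, base-changed
to the small coset category along `cosetConnectedFunctor`.  At `U ∈ CosetCat Γ`: `Φ₀^geom(Γ/U) = Hom_Γ(Γ/U, Div⁺) = (ℕ^{cusps ⊔ components})^U`
(print's recipe `Div⁺(Z_∞)^{Gal(Z_∞/Y)}`: at `U` acting trivially on `C` the whole `n`-cycle ⊔ cusps, at `U = Γ` with `C` one orbit the single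
component `[F]` and the cusp orbits of `X̲̲_v`), `B₀^geom(Γ/U) = Hom_Γ(Γ/U, ⟨Θ̈-translates⟩)`, `div₀^geom` = «log-divisor of zeroes and poles»,
`F₀ = 1`, `ncsp₀/csp₀`; all twelve fields definitions/theorems of the builder.  GA-02 instantiates at `Γ := ΓΘ T = P ⧸ NΘ T`, `C := ΓΘ T ⧸ Ȳ_T`
(`Ȳ_T` = image of `T.Y`; `n_T = [P : T.Y]` components) and precomposes with `rebase T`.
CARRIER LABEL (RULINGS #322 (c3′), verbatim): «carrier: genuine-by-[EtTh]-recipe on the T-lattice (Ÿ_T, Ÿ_T × V, X̲̲_v̲ × V) + constants everywhere;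
off-lattice Φ via `rebase`/pullback; [EtTh] Def 3.3 Φ at general U and print's Ÿ̈/μ_N Kummer levels = FOUNDATIONS 13/14, not claimed».  GUARD (#322,
verbatim): «for a `T` that is not a finite level of the theta tower the carrier is print's recipe TRANSPORTED by (n_T, e(V|K_v̲))».  LEVEL-MODEL DECREE
(this item): `Fn` = free on the Θ̈-translates (ϖ̈-free, Ü-free, sign-free; NO constants — they enter via `T.proj ⋙ constTower d`), zero divisor of every
translate = all cusps with multiplicity 1 (print), polar divisor of `Θ̈_c` DECREED `[F_c]` (print's `D_1 = Σ j²F_j` descends to no finite level).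
[cite: MochizukiEtTh2009, Def 3.3 p.73] -/
def divisorsGeom : DivisorMonoids.{0, 0, 0} (CosetCat Γ) :=
  (DivisorMonoids.ofGaloisActionConnected (Envelope.action C Γ) (Envelope.cuspLaws C)).precomp (cosetConnectedFunctor Γ)

/-- **`divisorsGeom` IS GA-02's engine route on the nose**: the base change of abc-iut-w6-d058's `ofGaloisAction` along `cosetGSetFunctor`.
[cite: MochizukiEtTh2009, Def 3.3 p.73] -/
theorem divisorsGeom_eq :
    divisorsGeom Γ C = (DivisorMonoids.ofGaloisAction (Envelope.action C Γ) (Envelope.cuspLaws C)).precomp (cosetGSetFunctor Γ) := rfl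

/-- `Φ₀^geom(Γ/U) = Hom_Γ(Γ/U, Div⁺)`. [cite: MochizukiEtTh2009, Def 3.3 p.73] -/
theorem divisorsGeom_Φ₀_obj (U : (CosetCat Γ)ᵒᵖ) :
    (divisorsGeom Γ C).Φ₀.obj U = (Envelope.action C Γ).PhiZero.obj (op (Action.ofMulAction Γ U.unop.carrier)) := rfl

/-- `B₀^geom(Γ/U) = Hom_Γ(Γ/U, ⟨Θ̈-translates⟩)`. [cite: MochizukiEtTh2009, Def 3.3 p.73] -/
theorem divisorsGeom_B₀_obj (U : (CosetCat Γ)ᵒᵖ) :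
    (divisorsGeom Γ C).B₀.obj U = (Envelope.action C Γ).BZero.obj (op (Action.ofMulAction Γ U.unop.carrier)) := rfl

/-- `div₀^geom` at `Γ/U` is abc-iut-w6-d058's `divZeroHom`. [cite: MochizukiEtTh2009, Def 3.3 p.73] -/
theorem divisorsGeom_div₀ (U : (CosetCat Γ)ᵒᵖ) :
    (divisorsGeom Γ C).div₀ U = (Envelope.action C Γ).divZeroHom (Action.ofMulAction Γ U.unop.carrier) := rfl

/-- `F₀^geom(Γ/U)` = the sections valued in the (trivial) constants of the level. [cite: MochizukiEtTh2009, Def 3.3 p.73] -/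
theorem divisorsGeom_F₀ (U : (CosetCat Γ)ᵒᵖ) :
    (divisorsGeom Γ C).F₀ U = (Envelope.action C Γ).fZero (Action.ofMulAction Γ U.unop.carrier) := rfl

/-- `Φ₀^geom` on a morphism is pull-back along the map of coset spaces. [cite: MochizukiEtTh2009, Def 3.3 p.73] -/
theorem divisorsGeom_Φ₀_map_apply {U V : (CosetCat Γ)ᵒᵖ} (f : U ⟶ V) (φ : (divisorsGeom Γ C).Φ₀.obj U) (x : V.unop.carrier) :
    (((divisorsGeom Γ C).Φ₀.map f).hom φ).1 x = φ.1 (CosetCat.Hom.toFun f.unop x) := rfl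

/-- `B₀^geom` on a morphism is pull-back along the map of coset spaces. [cite: MochizukiEtTh2009, Def 3.3 p.73] -/
theorem divisorsGeom_B₀_map_apply {U V : (CosetCat Γ)ᵒᵖ} (f : U ⟶ V) (b : (divisorsGeom Γ C).B₀.obj U) (x : V.unop.carrier) :
    (((divisorsGeom Γ C).B₀.map f).hom b).1 x = b.1 (CosetCat.Hom.toFun f.unop x) := rfl

/-- **The transition maps of `Φ₀^geom` are injective** (covering maps of coset spaces are onto). [cite: MochizukiEtTh2009, Def 3.3 p.73] -/
theorem divisorsGeom_Φ₀_map_injective {U V : (CosetCat Γ)ᵒᵖ} (f : U ⟶ V) : Function.Injective ((divisorsGeom Γ C).Φ₀.map f).hom :=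
  DivisorMonoids.ofGaloisActionConnected_Φ₀_map_injective (Envelope.action C Γ) (Envelope.cuspLaws C) ((cosetConnectedFunctor Γ).map f.unop).op

/-- **The transition maps of `B₀^geom` are injective.** [cite: MochizukiEtTh2009, Def 3.3 p.73] -/
theorem divisorsGeom_B₀_map_injective {U V : (CosetCat Γ)ᵒᵖ} (f : U ⟶ V) : Function.Injective ((divisorsGeom Γ C).B₀.map f).hom :=
  DivisorMonoids.ofGaloisActionConnected_B₀_map_injective (Envelope.action C Γ) (Envelope.cuspLaws C) ((cosetConnectedFunctor Γ).map f.unop).op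

/-! ## §3 The theta section over `Ÿ = Γ/Y` and its `div₀` (transport of `div₀_thetaB₀`) -/

variable {Γ C}

/-- The object `Γ/Y` of the small coset category (print: `Ÿ_v` «as an object of `D_v`», [IUTchI] Ex. 3.2 (ii); GA-02: `rebase T T.ydd`).
[cite: Mochizuki2012, I Ex 3.2 (ii) p.70] -/
abbrev cosetObj (Y : OpenSubgroup Γ) : CosetCat Γ := ⟨Y⟩

/-- A section of `B₀^geom(Γ/Y)` with value `Θ̈_{c₀}` at the base point exists as soon as `Y` stabilises the component `c₀`
(abc-iut-w6-d058's `B₀(G/H) = Mero^H`). [cite: MochizukiEtTh2009, Def 3.3 (iii) p.73] -/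
theorem exists_thetaSection (Y : OpenSubgroup Γ) {c₀ : C} (hY : ∀ y ∈ Y, y • c₀ = c₀) : ∃ b : (Envelope.action C Γ).bZero (Action.ofMulAction Γ (cosetObj Y).carrier),
    b.1 ((1 : Γ) : (cosetObj Y).carrier) = Envelope.theta c₀ :=
  (Envelope.action C Γ).exists_bZero_quotient_of_invariant Y.toSubgroup (Envelope.theta_mem_logMero c₀) fun y hy => by
    rw [Envelope.actFn_theta, hY y hy]

/-- **THE THETA SECTION `θ ∈ B₀^geom(Γ/Y)`**: the equivariant family `γ·Y ↦ Θ̈_{γ•c₀}` — print's `Θ̈ ∈ K_Ÿ` read on the covering `Ÿ = Γ/Y`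
(pattern: the fourth model's `thetaFam` / `thetaB₀`). [cite: MochizukiEtTh2009, §5 p.330] -/
def thetaSection (Y : OpenSubgroup Γ) {c₀ : C} (hY : ∀ y ∈ Y, y • c₀ = c₀) : (divisorsGeom Γ C).B₀.obj (op (cosetObj Y)) := (exists_thetaSection Y hY).choose

/-- `θ(1·Y) = Θ̈_{c₀}`. [cite: MochizukiEtTh2009, §5 p.330] -/
theorem thetaSection_apply_one (Y : OpenSubgroup Γ) {c₀ : C} (hY : ∀ y ∈ Y, y • c₀ = c₀) : (thetaSection Y hY).1 ((1 : Γ) : (cosetObj Y).carrier) = Envelope.theta c₀ :=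
  (exists_thetaSection Y hY).choose_spec

/-- **`θ(γ·Y) = Θ̈_{γ•c₀}`.** [cite: MochizukiEtTh2009, §5 p.330] -/
theorem thetaSection_apply_mk (Y : OpenSubgroup Γ) {c₀ : C} (hY : ∀ y ∈ Y, y • c₀ = c₀) (g : Γ) : (thetaSection Y hY).1 (g : (cosetObj Y).carrier) = Envelope.theta (g • c₀) := by
  rw [(Envelope.action C Γ).bZero_quotient_apply Y.toSubgroup (thetaSection Y hY) g, thetaSection_apply_one, Envelope.actFn_theta]

variable (C) in
/-- **The family of ZERO divisors** of the theta translates as an element of `Φ₀^geom(Γ/U)` for EVERY `U` (constant family of all cusps; equivariant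
because INVARIANT) — a non-trivial CUSPIDAL element. [cite: MochizukiEtTh2009, Prop 1.4 p.21] -/
def thetaZerosΦ₀ (U : CosetCat Γ) : (divisorsGeom Γ C).Φ₀.obj (op U) :=
  ⟨fun _ => (Envelope.thetaZeros C : (Envelope.model C).DIV), fun _ => ⟨trivial, (Envelope.thetaZeros C).2⟩,
    fun g _ => (Envelope.actDIV_thetaZeros C Γ g).symm⟩

/-- Its values. [cite: MochizukiEtTh2009, Prop 1.4 p.21] -/
@[simp] theorem thetaZerosΦ₀_apply (U : CosetCat Γ) (x : U.carrier) :
    (thetaZerosΦ₀ C U).1 x = (Envelope.thetaZeros C : (Envelope.model C).DIV) := rfl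

/-- A section of `Φ₀^geom(Γ/Y)` with value `[F_{c₀}]` at the base point exists. [cite: MochizukiEtTh2009, Def 3.3 (iii) p.73] -/
theorem exists_thetaPolesΦ₀ (Y : OpenSubgroup Γ) {c₀ : C} (hY : ∀ y ∈ Y, y • c₀ = c₀) : ∃ φ : (Envelope.action C Γ).phiZero (Action.ofMulAction Γ (cosetObj Y).carrier),
    φ.1 ((1 : Γ) : (cosetObj Y).carrier) = (Envelope.thetaPoles c₀ : (Envelope.model C).DIV) :=
  (Envelope.action C Γ).exists_phiZero_quotient_of_invariant Y.toSubgroup ⟨trivial, (Envelope.thetaPoles c₀).2⟩ fun y hy => by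
    rw [Envelope.actDIV_thetaPoles, hY y hy]

/-- **The family of POLAR divisors** `γ·Y ↦ [F_{γ•c₀}]` in `Φ₀^geom(Γ/Y)` (pattern: `thetaPolesFam`). [cite: MochizukiEtTh2009, Prop 1.4 p.21] -/
def thetaPolesΦ₀ (Y : OpenSubgroup Γ) {c₀ : C} (hY : ∀ y ∈ Y, y • c₀ = c₀) : (divisorsGeom Γ C).Φ₀.obj (op (cosetObj Y)) := (exists_thetaPolesΦ₀ Y hY).choose

/-- Its value at the base point. [cite: MochizukiEtTh2009, Prop 1.4 p.21] -/
theorem thetaPolesΦ₀_apply_one (Y : OpenSubgroup Γ) {c₀ : C} (hY : ∀ y ∈ Y, y • c₀ = c₀) :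
    (thetaPolesΦ₀ Y hY).1 ((1 : Γ) : (cosetObj Y).carrier) = (Envelope.thetaPoles c₀ : (Envelope.model C).DIV) :=
  (exists_thetaPolesΦ₀ Y hY).choose_spec

/-- **Its values: `[F_{γ•c₀}]` at `γ·Y`.** [cite: MochizukiEtTh2009, Prop 1.4 p.21] -/
theorem thetaPolesΦ₀_apply_mk (Y : OpenSubgroup Γ) {c₀ : C} (hY : ∀ y ∈ Y, y • c₀ = c₀) (g : Γ) :
    (thetaPolesΦ₀ Y hY).1 (g : (cosetObj Y).carrier) = (Envelope.thetaPoles (g • c₀) : (Envelope.model C).DIV) := by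
  have h := (show (Envelope.action C Γ).phiZero (Action.ofMulAction Γ (cosetObj Y).carrier) from thetaPolesΦ₀ Y hY).2.2 g
    ((1 : Γ) : (cosetObj Y).carrier)
  rw [Action.ofMulAction_apply, MulAction.Quotient.smul_coe, smul_eq_mul, mul_one, thetaPolesΦ₀_apply_one,
    Envelope.actDIV_thetaPoles] at h
  exact h

/-- The zero family is CUSPIDAL: `thetaZerosΦ₀ U ∈ csp₀(Γ/U)`. [cite: MochizukiEtTh2009, Def 3.6 (iii) p.77] -/
theorem thetaZerosΦ₀_mem_csp₀ (U : CosetCat Γ) : thetaZerosΦ₀ C U ∈ (divisorsGeom Γ C).csp₀ (op U) :=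
  fun _ => Envelope.thetaZeros_mem_cuspidal

/-- The polar family is NON-CUSPIDAL: `thetaPolesΦ₀ ∈ ncsp₀(Γ/Y)`. [cite: MochizukiEtTh2009, Def 3.6 (iii) p.77] -/
theorem thetaPolesΦ₀_mem_ncsp₀ (Y : OpenSubgroup Γ) {c₀ : C} (hY : ∀ y ∈ Y, y • c₀ = c₀) : thetaPolesΦ₀ Y hY ∈ (divisorsGeom Γ C).ncsp₀ (op (cosetObj Y)) := fun y => by
  obtain ⟨g, rfl⟩ := QuotientGroup.mk_surjective y
  change (thetaPolesΦ₀ Y hY).1 (g : (cosetObj Y).carrier) ∈ (Envelope.model C).nonCuspidal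
  rw [thetaPolesΦ₀_apply_mk]
  exact (Envelope.thetaPoles_mem_nonCuspidal _).1

/-- The zero family is non-trivial. [cite: MochizukiEtTh2009, Prop 1.4 p.21] -/
theorem thetaZerosΦ₀_ne_one [Nonempty C] (U : CosetCat Γ) : thetaZerosΦ₀ C U ≠ 1 := fun e => by
  have e1 := congrArg (fun ψ : (divisorsGeom Γ C).Φ₀.obj (op U) => ψ.1 ((1 : Γ) : U.carrier)) e
  exact Envelope.thetaZeros_ne_one (Subtype.ext e1)

/-- **`div₀ θ = [zeros] / [poles]` in `Φ₀^geom(Γ/Y)^gp`** — Def. 3.3 (iii)'s «log-divisor of zeroes and poles» of the theta section: numerator the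
constant family of all cusps, denominator the family `γ·Y ↦ [F_{γ•c₀}]` (TRANSPORT of the fourth model's `div₀_thetaB₀`,
`ThetaFractionPairOfThetaTwistTower.lean`). [cite: MochizukiEtTh2009, Def 3.3 (iii) p.73] -/
theorem div₀_thetaSection (Y : OpenSubgroup Γ) {c₀ : C} (hY : ∀ y ∈ Y, y • c₀ = c₀) : (divisorsGeom Γ C).div₀ (op (cosetObj Y)) (thetaSection Y hY) =
    Algebra.GrothendieckGroup.of (thetaZerosΦ₀ C (cosetObj Y)) / Algebra.GrothendieckGroup.of (thetaPolesΦ₀ Y hY) := by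
  refine ((Envelope.action C Γ).divZeroHom_eq_div_iff (Action.ofMulAction Γ (cosetObj Y).carrier) (thetaSection Y hY)
    (thetaZerosΦ₀ C (cosetObj Y)) (thetaPolesΦ₀ Y hY)).2 fun y => ?_
  obtain ⟨g, rfl⟩ := QuotientGroup.mk_surjective y
  have e : (⟨(thetaSection Y hY).1 (g : (cosetObj Y).carrier), (thetaSection Y hY).2.1 _⟩ : (Envelope.model C).logMero) =
      ⟨Envelope.theta (g • c₀), Envelope.theta_mem_logMero _⟩ := Subtype.ext (thetaSection_apply_mk Y hY g)
  rw [LogDivisorModel.GaloisAction.divAt, e, Envelope.divisor_theta, thetaPolesΦ₀_apply_mk, thetaZerosΦ₀_apply, div_mul_cancel]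

/-- Product form: `div₀ θ · [poles] = [zeros]`. [cite: MochizukiEtTh2009, Def 3.3 (iii) p.73] -/
theorem div₀_thetaSection_mul (Y : OpenSubgroup Γ) {c₀ : C} (hY : ∀ y ∈ Y, y • c₀ = c₀) :
    (divisorsGeom Γ C).div₀ (op (cosetObj Y)) (thetaSection Y hY) * Algebra.GrothendieckGroup.of (thetaPolesΦ₀ Y hY) =
      Algebra.GrothendieckGroup.of (thetaZerosΦ₀ C (cosetObj Y)) :=
  eq_div_iff_mul_eq'.mp (div₀_thetaSection Y hY)

/-- **The two families have DISJOINT SUPPORTS** (zeros on the cusps, poles on the components): at every point and every prime log-divisor one of the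
two multiplicities vanishes ([FrdI] Def. 4.1 (i) «`Div(s′)`, `Div(s″)` have disjoint supports» shape). [cite: MochizukiEtTh2009, Def 4.1 (i) p.86] -/
theorem thetaZerosΦ₀_disjoint_thetaPolesΦ₀ (Y : OpenSubgroup Γ) {c₀ : C} (hY : ∀ y ∈ Y, y • c₀ = c₀) (y : (cosetObj Y).carrier) (x : Envelope.Idx C) :
    Multiplicative.toAdd ((thetaZerosΦ₀ C (cosetObj Y)).1 y) x = 0 ∨ Multiplicative.toAdd ((thetaPolesΦ₀ Y hY).1 y) x = 0 := by
  obtain ⟨g, rfl⟩ := QuotientGroup.mk_surjective y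
  rw [thetaZerosΦ₀_apply, thetaPolesΦ₀_apply_mk, Envelope.toAdd_thetaZeros, Envelope.toAdd_thetaPoles]
  rcases x with q | c
  · exact Or.inr rfl
  · exact Or.inl rfl

/-- **The tautological component set `C := Γ/Y`** (print: the components of the special fibre of `Y` ARE the torsor `Gal(Y/X) = Π_X/Π_Y`;
GA-02 route (ii): `C := P ⧸ T.Y`): the subgroup `Y` stabilises the base component `1·Y`. [cite: MochizukiEtTh2009, Rmk 3.3.1 p.73] -/
theorem smul_base_eq_of_mem (Y : OpenSubgroup Γ) :
    ∀ y ∈ Y, y • ((1 : Γ) : Γ ⧸ Y.toSubgroup) = ((1 : Γ) : Γ ⧸ Y.toSubgroup) := fun y hy => by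
  rw [MulAction.Quotient.smul_coe, smul_eq_mul, mul_one]
  exact QuotientGroup.eq.mpr (by rw [mul_one, inv_mem_iff]; exact hy)

/-- **The theta section of `Ÿ = Γ/Y` with its OWN cosets as components** (`C := Γ/Y`, base component `1·Y`): `γ·Y ↦ Θ̈_{γ·Y}` — the canonical
instance of `thetaSection` (GA-02 route (ii) at `Γ := P`, `Y := T.Y`). [cite: MochizukiEtTh2009, §5 p.330] -/
def thetaSectionSelf (Y : OpenSubgroup Γ) : (divisorsGeom Γ (Γ ⧸ Y.toSubgroup)).B₀.obj (op (cosetObj Y)) :=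
  thetaSection Y (smul_base_eq_of_mem Y)

/-- Its values: `Θ̈_{γ·Y}` at `γ·Y`. [cite: MochizukiEtTh2009, §5 p.330] -/
theorem thetaSectionSelf_apply_mk (Y : OpenSubgroup Γ) (g : Γ) :
    (thetaSectionSelf Y).1 (g : (cosetObj Y).carrier) = Envelope.theta ((g : Γ ⧸ Y.toSubgroup)) := by
  rw [thetaSectionSelf, thetaSection_apply_mk, MulAction.Quotient.smul_coe, smul_eq_mul, mul_one]

end Geom

end ArithThetaTower

end Literature.AnabelianGeometry.EtaleTheta

end
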